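import Literature.Barriers.RiemannHypothesis.EpsteinZetaRealZerosPairGroupingLow
import HarnessLib

/-!
# Low's grouping for `d = 403`: `L(σ, χ_{−d}) > 0` on `(0, 1)` by pairing the principal class

Barrier audit (D-0021) of `Literature.Barriers.RiemannHypothesis.EpsteinZetaRealZeros`, continued
(generation 9, 2026-08-27): instances of `EpsteinZetaRealZerosPairGrouping.lean`. Everything here is
PROVED (theorems only).

* `d = 403` (`h(−403) = 2`, reduced classes `(1, 1, 101)` and `(11, 9, 11)`; heights
  `√403/2 = 10.037…` and `√403/22 = 0.912…` — the partner is ROUND, `|z₂| = 1`): `re_Λ_pair_neg_403`,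
  `LFunction_re_pos_of_odd_quadratic_403`, `LFunction_ne_zero_of_odd_quadratic_403`, by the MIXED
  criterion of `EpsteinZetaRealZerosPairGroupingLow.lean` (decomposition for the principal class,
  `Re Λ ≤ 5/6 − 1/σ − 1/(1−σ)` for the round class).

`d = 403` is the last odd wall below the even wall `437` of the hypothesis-free wide floor: with it the
odd kernel base reaches `436`.

## Proof shape (per discriminant)

`keyIneq_403` is the elementary inequality of `mixed_cell` on finitely many cells in `u = 2σ − 1`
(rational data `Y ≥ y₁`, `X`, `W` with integer-power certificates decided by `norm_num`), with an
extra margin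
`δ₀` on the cells next to `u = 0` that feeds the continuity argument at `σ = ½`;
`re_Λ_pair_neg_403` combines it with the analytic core `re_Λ_add_re_Λ_lt_of_mixedKey` and
`re_add_re_neg_of_Ioo_half_one`; `LFunction_re_pos_of_odd_quadratic_403` is `LFunction_re_pos_of_pair`
with the two reduced classes written out (discriminant by `norm_num`, reducedness and primitivity by
`decide`).

## References

* [Low1968] M. E. Low, Acta Arith. 14 (1968) 117–140, Theorem 5 (via MR 38#4425).
* [Watkins2004RealZeros] M. Watkins, Math. Comp. 73 (2004) 415–423, Theorem (p. 416): no real zero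
  on `(0, ∞)` for every odd real primitive character of conductor `≤ 3·10⁸` — the three characters
  here are instances, now kernel-checked.
-/

noncomputable section

open Complex Filter Topology MeasureTheory Set HurwitzZeta
open scoped UpperHalfPlane

namespace Literature.Barriers.RiemannHypothesis

open Literature.NumberTheory.Automorphic
open Literature.NumberTheory.LFunctions.RealZeros
open Literature.NumberTheory.QuadraticFields.BinaryQuadraticForm (discr_apply)

/-- **The mixed key inequality for `d = 403`** (principal height `y₁ = √403/2 = 10.03…`, `M = 0.0236`,
`B = β₁ + 5/12` with `β₁ = 1/1000` and the margin `δ₀ = 1 / 20` on `u ≤ 1 / 20`), by 13 cells of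
`mixed_cell` (smallest slack `0.025`). [folklore] -/
private theorem keyIneq_403 {y₁ u : ℝ} (hy1 : y₁ = Real.sqrt 403 / 2) (hu0 : 0 < u) (hu1 : u < 1) :
    y₁ ^ ((1 + u) / 2) * (0.0236 - 1 / (1 + u) + 1 / u) +
      y₁ ^ ((1 - u) / 2) * (0.0236 - 1 / (1 - u) - 1 / u) +
      (1253 / 3000 + if u ≤ 1 / 20 then (1 / 20 : ℝ) else 0) - 1 / (1 + u) - 1 / (1 - u) ≤ 0 := by
  have hS : Real.sqrt 403 ≤ 20.07487 := by
    rw [Real.sqrt_le_left (by norm_num)]; norm_num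
  have hS' : (20.07 : ℝ) ≤ Real.sqrt 403 := by
    rw [Real.le_sqrt (by norm_num) (by norm_num)]; norm_num
  have hy1one : 1 ≤ y₁ := by rw [hy1]; linarith
  have hY1 : y₁ ≤ 10.037435 := by rw [hy1]; linarith
  have cell : ∀ (p q X W B : ℝ) (kq nq ke ne : ℕ), nq ≠ 0 → q * nq = kq → 0 ≤ X →
      (10.037435 : ℝ) ^ kq ≤ X ^ nq → ne ≠ 0 → (1 - p) / 2 * ne = ke → 0 ≤ W →
      (10.037435 : ℝ) ^ ke ≤ W ^ ne → p ≤ u → u ≤ q → 0 ≤ p → 0 ≤ B → B ≤ 2 →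
      W * ((1 - p) * ((X - 1) / q + (1 + q) * (0.0236 * (X + 1))) - 2) ≤ 2 - (1 - p ^ 2) * B →
      y₁ ^ ((1 + u) / 2) * (0.0236 - 1 / (1 + u) + 1 / u) +
        y₁ ^ ((1 - u) / 2) * (0.0236 - 1 / (1 - u) - 1 / u) + B - 1 / (1 + u) - 1 / (1 - u) ≤ 0 :=
    fun p q X W B kq nq ke ne hnq hq hX0 hX hne he hW0 hW hp hq' hp0 hB0 hB2 hc =>
      mixed_cell hy1one hY1 hnq hq hX0 hX hne he hW0 hW hp hu0 hq' hu1 hp0 (by norm_num) hB0 hB2 hc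
  split_ifs with hδ
  · -- `u ≤ 1/20`: the cells carrying the margin `δ₀`
    rcases le_or_gt u (1 / 40) with hc0 | hc0
    · exact cell (0) (1 / 40) 1.0595 3.1683 (1253 / 3000 + 1 / 20) 1 40 1 2
        (by norm_num) (by norm_num) (by norm_num) (by norm_num) (by norm_num) (by norm_num) (by norm_num) (by norm_num) hu0.le hc0
        (by norm_num) (by norm_num) (by norm_num) (by norm_num)
    exact cell (1 / 40) (1 / 20) 1.1224 3.0783 (1253 / 3000 + 1 / 20) 1 20 39 80
        (by norm_num) (by norm_num) (by norm_num) (by norm_num) (by norm_num) (by norm_num) (by norm_num) (by norm_num) hc0.le hδ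
        (by norm_num) (by norm_num) (by norm_num) (by norm_num)
  · have hδ' : (1 / 20 : ℝ) < u := lt_of_not_ge hδ
    rcases le_or_gt u (1 / 10) with hc0 | hc0
    · exact cell (1 / 20) (1 / 10) 1.2595 2.9908 (1253 / 3000 + 0) 1 10 19 40
        (by norm_num) (by norm_num) (by norm_num) (by norm_num) (by norm_num) (by norm_num) (by norm_num) (by norm_num) hδ'.le hc0
        (by norm_num) (by norm_num) (by norm_num) (by norm_num)
    rcases le_or_gt u (3 / 20) with hc1 | hc1
    · exact cell (1 / 10) (3 / 20) 1.4135 2.8233 (1253 / 3000 + 0) 3 20 9 20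
        (by norm_num) (by norm_num) (by norm_num) (by norm_num) (by norm_num) (by norm_num) (by norm_num) (by norm_num) hc0.le hc1
        (by norm_num) (by norm_num) (by norm_num) (by norm_num)
    rcases le_or_gt u (1 / 5) with hc2 | hc2
    · exact cell (3 / 20) (1 / 5) 1.5862 2.6651 (1253 / 3000 + 0) 1 5 17 40
        (by norm_num) (by norm_num) (by norm_num) (by norm_num) (by norm_num) (by norm_num) (by norm_num) (by norm_num) hc1.le hc2
        (by norm_num) (by norm_num) (by norm_num) (by norm_num)
    rcases le_or_gt u (1 / 4) with hc3 | hc3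
    · exact cell (1 / 5) (1 / 4) 1.7801 2.5158 (1253 / 3000 + 0) 1 4 2 5
        (by norm_num) (by norm_num) (by norm_num) (by norm_num) (by norm_num) (by norm_num) (by norm_num) (by norm_num) hc2.le hc3
        (by norm_num) (by norm_num) (by norm_num) (by norm_num)
    rcases le_or_gt u (3 / 10) with hc4 | hc4
    · exact cell (1 / 4) (3 / 10) 1.9977 2.3748 (1253 / 3000 + 0) 3 10 3 8
        (by norm_num) (by norm_num) (by norm_num) (by norm_num) (by norm_num) (by norm_num) (by norm_num) (by norm_num) hc3.le hc4
        (by norm_num) (by norm_num) (by norm_num) (by norm_num)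
    rcases le_or_gt u (7 / 20) with hc5 | hc5
    · exact cell (3 / 10) (7 / 20) 2.2418 2.2418 (1253 / 3000 + 0) 7 20 7 20
        (by norm_num) (by norm_num) (by norm_num) (by norm_num) (by norm_num) (by norm_num) (by norm_num) (by norm_num) hc4.le hc5
        (by norm_num) (by norm_num) (by norm_num) (by norm_num)
    rcases le_or_gt u (2 / 5) with hc6 | hc6
    · exact cell (7 / 20) (2 / 5) 2.5158 2.1162 (1253 / 3000 + 0) 2 5 13 40
        (by norm_num) (by norm_num) (by norm_num) (by norm_num) (by norm_num) (by norm_num) (by norm_num) (by norm_num) hc5.le hc6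
        (by norm_num) (by norm_num) (by norm_num) (by norm_num)
    rcases le_or_gt u (1 / 2) with hc7 | hc7
    · exact cell (2 / 5) (1 / 2) 3.1683 1.9977 (1253 / 3000 + 0) 1 2 3 10
        (by norm_num) (by norm_num) (by norm_num) (by norm_num) (by norm_num) (by norm_num) (by norm_num) (by norm_num) hc6.le hc7
        (by norm_num) (by norm_num) (by norm_num) (by norm_num)
    rcases le_or_gt u (13 / 20) with hc8 | hc8
    · exact cell (1 / 2) (13 / 20) 4.4778 1.7801 (1253 / 3000 + 0) 13 20 1 4
        (by norm_num) (by norm_num) (by norm_num) (by norm_num) (by norm_num) (by norm_num) (by norm_num) (by norm_num) hc7.le hc8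
        (by norm_num) (by norm_num) (by norm_num) (by norm_num)
    rcases le_or_gt u (17 / 20) with hc9 | hc9
    · exact cell (13 / 20) (17 / 20) 7.1021 1.4974 (1253 / 3000 + 0) 17 20 7 40
        (by norm_num) (by norm_num) (by norm_num) (by norm_num) (by norm_num) (by norm_num) (by norm_num) (by norm_num) hc8.le hc9
        (by norm_num) (by norm_num) (by norm_num) (by norm_num)
    exact cell (17 / 20) (1) 10.037435 1.189 (1253 / 3000 + 0) 1 1 3 40
        (by norm_num) (by norm_num) (by norm_num) (by norm_num) (by norm_num) (by norm_num) (by norm_num) (by norm_num) hc9.le hu1.le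
        (by norm_num) (by norm_num) (by norm_num) (by norm_num)

/-- **`Re Λ_{z₁}(σ) + Re Λ_{z₂}(σ) < 0` on `(0, 1)` for the two classes of discriminant `−403`**
(`Im z₁ = √403/2 = 10.03…`, the principal class, by the constant-term decomposition; `Im z₂ = √403/22
= 0.912…`, the round class `(11, 9, 11)`, by `re_Λ_le_of_im_le_one`). [cite: Low1968, Theorem 5 (via MR 38#4425)] -/
theorem re_Λ_pair_neg_403 (z₁ z₂ : ℍ) (h1 : z₁.im = Real.sqrt 403 / 2)
    (h2 : z₂.im = Real.sqrt 403 / 22) {σ : ℝ} (hσ0 : 0 < σ) (hσ1 : σ < 1) :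
    ((thetaFEPair z₁).Λ σ).re + ((thetaFEPair z₂).Λ σ).re < 0 := by
  have hS : Real.sqrt 403 ≤ 20.07487 := by
    rw [Real.sqrt_le_left (by norm_num)]; norm_num
  have hS' : (20.07 : ℝ) ≤ Real.sqrt 403 := by
    rw [Real.le_sqrt (by norm_num) (by norm_num)]; norm_num
  have hy1 : 1 ≤ z₁.im := by rw [h1]; linarith
  have hy2 : 4 / 5 ≤ z₂.im := by rw [h2, le_div_iff₀ (by norm_num)]; linarith
  have hy2' : z₂.im ≤ 1 := by rw [h2, div_le_iff₀ (by norm_num)]; linarith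
  have hE1 : 48 * Real.sqrt z₁.im * Real.exp (-(7 / 5) * Real.pi * z₁.im) ≤ 2 * (1 / 1000 : ℝ) :=
    bessel_allowance_of_three_le (by rw [h1]; linarith) (by rw [h1]; linarith)
  have hmain : ∀ τ : ℝ, 1 / 2 < τ → τ < 1 → ((thetaFEPair z₁).Λ τ).re + ((thetaFEPair z₂).Λ τ).re <
      -(2 * (if 2 * τ - 1 ≤ (1 / 20 : ℝ) then (1 / 20 : ℝ) else 0)) := by
    intro τ hτ hτ1
    have hu0 : 0 < 2 * τ - 1 := by linarith
    have hu1 : 2 * τ - 1 < 1 := by linarith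
    have hk := keyIneq_403 h1 hu0 hu1
    rw [show (1 + (2 * τ - 1)) / 2 = τ by ring, show (1 - (2 * τ - 1)) / 2 = 1 - τ by ring] at hk
    refine re_Λ_add_re_Λ_lt_of_mixedKey z₁ z₂ hy1 hy2 hy2' hτ hτ1 (β₁ := 1 / 1000) hE1 ?_
    convert hk using 2; split_ifs <;> ring
  refine re_add_re_neg_of_Ioo_half_one z₁ z₂ (c := 2 * (1 / 20 : ℝ)) (ε := 1 / 40)
    (by norm_num) (by norm_num) (fun τ hτ hτ1 => ?_) (fun τ hτ hτ1 => ?_) hσ0 hσ1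
  · have h := hmain τ hτ hτ1
    have h0 : (0 : ℝ) ≤ 2 * (if 2 * τ - 1 ≤ (1 / 20 : ℝ) then (1 / 20 : ℝ) else 0) := by
      split_ifs <;> norm_num
    linarith
  · have h := hmain τ hτ (by linarith)
    rw [if_pos (by linarith)] at h
    exact h.le

/-- **`Re L(σ, χ) > 0` on all of `(0, 1)` for the odd real primitive character mod `403`**
(`h(−403) = 2`, reduced classes `(1, 1, 101)` and `(11, 9, 11)`, the latter ROUND: height
`√403/22 < 1`; no Fekete–Pólya certificate of order `≤ 24` and modulus `≤ 3·10⁶`, and no order-two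
certificate along an induced character of modulus `≤ 7·10⁴`): Low's grouping, mixed form. In particular
`L(s, χ_{−403})` has no real zero in `(0, 1)`. [cite: Watkins2004RealZeros, Theorem (p. 416)] -/
theorem LFunction_re_pos_of_odd_quadratic_403 {χ : DirichletCharacter ℂ 403} (hprim : χ.IsPrimitive)
    (hquad : χ.IsQuadratic) (hodd : χ.Odd) {σ : ℝ} (hσ0 : 0 < σ) (hσ1 : σ < 1) :
    0 < (χ.LFunction σ).re := by
  refine LFunction_re_pos_of_pair (d := 403) (b₁ := 1) (c₁ := 101) (a₂ := 11) (b₂ := 9)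
    (c₂ := 11) (by norm_num) (by norm_num) hprim hquad hodd (by rw [discr_apply]; norm_num)
    (by decide) (by rw [discr_apply]; norm_num) (by decide) (by decide) (by norm_num) ?_ hσ0 hσ1
  intro Z₁ Z₂ hZ1 hZ2 τ hτ0 hτ1
  push_cast at hZ1 hZ2
  refine pair_re_neg_of_Λ (a₁ := 1) (b₁ := 1) (c₁ := 101) (a₂ := 11) (b₂ := 9) (c₂ := 11)
    ⟨by norm_num, by norm_num⟩ ⟨by norm_num, by norm_num⟩ (by norm_num) ?_ hZ1 hZ2 hτ0 hτ1
  intro z₁ z₂ hz1 hz2 σ' hσ'0 hσ'1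
  have e1 : z₁.im = Real.sqrt 403 / 2 := by rw [hz1, starkK]; norm_num
  have e2 : z₂.im = Real.sqrt 403 / 22 := by rw [hz2, starkK]; norm_num
  exact re_Λ_pair_neg_403 z₁ z₂ e1 e2 hσ'0 hσ'1

/-- **No real zero of `L(s, χ_{−403})` in `(0, 1)`.** [cite: Watkins2004RealZeros, Theorem (p. 416)] -/
theorem LFunction_ne_zero_of_odd_quadratic_403 {χ : DirichletCharacter ℂ 403} (hprim : χ.IsPrimitive)
    (hquad : χ.IsQuadratic) (hodd : χ.Odd) {σ : ℝ} (hσ0 : 0 < σ) (hσ1 : σ < 1) :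
    χ.LFunction σ ≠ 0 := by
  intro h0
  have h := LFunction_re_pos_of_odd_quadratic_403 hprim hquad hodd hσ0 hσ1
  rw [h0, Complex.zero_re] at h
  exact lt_irrefl _ h

end Literature.Barriers.RiemannHypothesis
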